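import Literature.NumberTheory.Automorphic.ArchRankinSelbergGapTestVector
import HarnessLib

/-!
# Consistency of the two archimedean named facts of line `Sketch`: Jacquet's corner fact implies the gap fact at
# corank one

Summit `Langlands`, sub-problem `Langlands`, helper file under `Theorems/` supporting the crux `PairLBoundaryJS`
(stmt-Langlands-13622), line `Sketch`, registered sub-stub `stub_gap_arch_fact_succ_of_corner` (lead c6): a transcription
sanity check relating the two archimedean Literature facts used by the skeleton —
`JacquetArchimedeanRS2009_archRankinSelbergCorner_testVector m K` (Jacquet (2009), Thm. 2.7 (i): for `GL_{m+1} × GL_m`,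
`Σ_i Ψ^corner_∞(s; e_i, e'_i) = c^s ∏Γ_ℝ ∏Γ_ℂ` with `K_∞`-finite data) IMPLIES
`JacquetShalika1990_archRankinSelbergGap_entireRatio (m + 1) m K` (the gap fact at `n = m + 1`: for every `s₀` a
`K_∞`-finite datum with `Σ_i Ψ^{(n,m)}_∞ = h · c^s ∏Γ`, `h` entire, `h(s₀) ≠ 0`): take the corner datum and `h = 1`
(`archGapPairIntegralCplx (Nat.le_succ m) = archCornerPairIntegralCplx`, `archGapPairIntegralCplx_le_succ`); the
integrability clauses coincide. So at corank one the gap fact asks for no more than Jacquet's printed theorem.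

## References

* H. Jacquet, *Archimedean Rankin–Selberg integrals*, Contemp. Math. 489 (2009), Thm. 2.1, Thm. 2.6, Thm. 2.7 (i)
  [JacquetArchimedeanRS2009].
* J. W. Cogdell, *Analytic theory of L-functions for GL_n* (2004), Thm. 3.5, §4.2 [CogdellAnalyticTheory2004].
-/

noncomputable section

-- `Summit.Langlands.Langlands.…` (summit = sub-problem name, D-0017 layout) trips `dupNamespace`
set_option linter.dupNamespace false

open MeasureTheory Measure NumberField NumberField.mixedEmbedding IsDedekindDomain Set Filter
open Literature.NumberTheory.Automorphic
open scoped MatrixGroups ENNReal NNReal ComplexConjugate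

namespace Summit.Langlands.Langlands.Theorems.GapArchFactSucc

/-- **Jacquet's corner fact implies the gap fact at corank one** (`h := 1`; the two pair integrals agree
definitionally at `hmn = Nat.le_succ m`). [cite: JacquetArchimedeanRS2009, Thm. 2.7 (i)] -/
theorem stub_gap_arch_fact_succ_of_corner :
    ∀ (m : ℕ) (K : Type) [Field K] [NumberField K],
      JacquetArchimedeanRS2009_archRankinSelbergCorner_testVector m K →
      JacquetShalika1990_archRankinSelbergGap_entireRatio (m + 1) m K := by
  intro m K _ _ hJ hmn hcpt hcpt' E _ _ _ τ hτ hu hirr ℓ hℓ hℓ0 E' _ _ _ τ' hτ' hu' hirr' ℓ' hℓ' hℓ'0 _ _ _ _ μA hμA μK hμK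
  obtain ⟨hi, hii⟩ := hJ hcpt hcpt' E τ hτ hu hirr ℓ hℓ hℓ0 E' τ' hτ' hu' hirr' ℓ' hℓ' hℓ'0 μA hμA μK hμK
  refine ⟨fun s₀ => ?_, fun e e' hfe hfe' => ?_⟩
  · obtain ⟨k, e, e', hfe, hfe', c, hc, d₁, d₂, a, b, x₀, hsum⟩ := hi
    refine ⟨k, e, e', hfe, hfe', c, hc, d₁, d₂, a, b, fun _ => 1, x₀, differentiable_const _, one_ne_zero,
      fun s hs => ?_⟩
    rw [one_mul, ← hsum s hs]
    rfl
  · obtain ⟨x₀, hx₀⟩ := hii e e' hfe hfe'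
    exact ⟨x₀, fun s hs => hx₀ s hs⟩

end Summit.Langlands.Langlands.Theorems.GapArchFactSucc

end
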